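import Literature.RepresentationTheory.CentralCharacterQuotient
import HarnessLib

/-!
# The maximal `χ`-quotient: functoriality along a SEMILINEAR intertwiner (Galois twist of the central character)

Topic `RepresentationTheory`; namespace `Literature.RepresentationTheory.CentralCharacterQuotient` (continuation of
`CentralCharacterQuotient.lean`, kernel construction `augmentation` / `quotRep`).  KERNEL ONLY: proved theorems, no
definition, no named fact, no `sorry`.

For a ring homomorphism `τ : k →+* k`, representations `ω₀` of `G` on `V₀` and `ω₁` of `G` on `V₁`, a homomorphism
`ζ : Z →* G` into the centre, characters `χ₀ χ₁ : Z →* kˣ` with `χ₁ = τ ∘ χ₀` (as `k`-valued functions) and a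
`τ`-SEMILINEAR intertwiner `Φ : V₀ →ₛₗ[τ] V₁` (`Φ (ω₀ g v) = ω₁ g (Φ v)`):
* `Φ` carries the `χ₀`-augmentation submodule into the `χ₁`-augmentation submodule
  (`augmentation_le_comap_semilinear`), and ONTO it when `Φ` is onto (`exists_mem_augmentation_apply_eq`);
* hence it descends to a `τ`-semilinear map of the maximal quotients which intertwines `quotRep ω₀ hζ χ₀` with
  `quotRep ω₁ hζ χ₁` (`mapQ_quotRep`), and which is BIJECTIVE when `Φ` is (`mapQ_bijective_of_bijective`);
* packaged existence form `exists_semilinear_quotRep_of_bijective` — the shape consumed by the cell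
  `hodgecm-mathlib`'s road to [Liu2021, Thm. 4.18 (3)] (binder `LocalTypeGaloisTwist` of the line `a3_liu418`, row
  III-11): the `σ`-twist of the local type `ω(μ, ε, χ)` (a maximal `χ`-quotient, [Liu2021, App. D §D.1 Step 3]) is the
  local type `ω(μ, ε', σ ∘ χ)` once a `σ`-semilinear bijective intertwiner of the oscillator models is given.
The twisted-coinvariant (`TwistedCoinv.Coinv`) edition of the same functoriality is `TwistedCoinvariantsSemilinear.lean`
(`TwistedCoinv.mapₛₗ`); this file is the `augmentation`/`quotRep` edition, which is the currency of
`LemD1Data.datum.quot` / `LemD1IndexedFamily.quot`.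

## References
* [Liu2021] Y. Liu, Camb. J. Math. 9 (2021), App. D §D.1 Step 3 (l. 5221: «the maximal quotient … on which the centre
  acts by `χ`»); Thm. 4.18 (3), proof l. 2272–2289 (Galois twist).
* [MoeglinVignerasWaldspurger1987] C. Mœglin, M.-F. Vignéras, J.-L. Waldspurger, LNM 1291 (1987), Chap. 2 II.1
  (transport of structure), Chap. 3 IV (maximal isotypic quotients).
-/

set_option autoImplicit false

namespace Literature.RepresentationTheory.CentralCharacterQuotient

universe uk uG uZ uV uW

variable {k : Type uk} {G : Type uG} {Z : Type uZ} {V₀ : Type uV} {V₁ : Type uW} [CommRing k] [Group G] [Group Z]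
  [AddCommGroup V₀] [Module k V₀] [AddCommGroup V₁] [Module k V₁] {τ : k →+* k}
variable (ω₀ : Representation k G V₀) (ω₁ : Representation k G V₁) (ζ : Z →* G) (χ₀ χ₁ : Z →* kˣ)

/-- a semilinear intertwiner on the centre carries generators of the augmentation submodule to generators:
`Φ (ω₀(ζ z) v − χ₀(z) v) = ω₁(ζ z) (Φ v) − χ₁(z) (Φ v)` when `χ₁ = τ ∘ χ₀`.
[cite: Liu2021, App. D §D.1 Step 3 (l. 5221); Thm. 4.18 (3) proof l. 2272–2289] -/
theorem semilinear_map_generator (Φ : V₀ →ₛₗ[τ] V₁) (hΦ : ∀ (z : Z) (v : V₀), Φ (ω₀ (ζ z) v) = ω₁ (ζ z) (Φ v))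
    (hχ : ∀ z : Z, ((χ₁ z : kˣ) : k) = τ ((χ₀ z : kˣ) : k)) (z : Z) (v : V₀) :
    Φ (ω₀ (ζ z) v - ((χ₀ z : kˣ) : k) • v) = ω₁ (ζ z) (Φ v) - ((χ₁ z : kˣ) : k) • Φ v := by
  rw [map_sub, LinearMap.map_smulₛₗ, hΦ, hχ]

/-- **the `χ₀`-augmentation submodule is carried into the `χ₁`-augmentation submodule** by a `τ`-semilinear
intertwiner (on the centre) with `χ₁ = τ ∘ χ₀`. [cite: Liu2021, App. D §D.1 Step 3 (l. 5221); Thm. 4.18 (3) proof l. 2272–2289] -/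
theorem augmentation_le_comap_semilinear (Φ : V₀ →ₛₗ[τ] V₁)
    (hΦ : ∀ (z : Z) (v : V₀), Φ (ω₀ (ζ z) v) = ω₁ (ζ z) (Φ v))
    (hχ : ∀ z : Z, ((χ₁ z : kˣ) : k) = τ ((χ₀ z : kˣ) : k)) :
    augmentation ω₀ ζ χ₀ ≤ (augmentation ω₁ ζ χ₁).comap Φ := by
  refine iSup_le fun z => ?_
  rintro _ ⟨v, rfl⟩
  simp only [Submodule.mem_comap, LinearMap.sub_apply, LinearMap.smul_apply, LinearMap.id_coe, id_eq]
  rw [semilinear_map_generator ω₀ ω₁ ζ χ₀ χ₁ Φ hΦ hχ z v]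
  exact sub_smul_mem_augmentation ω₁ ζ χ₁ z (Φ v)

/-- **onto**: if `Φ` is onto then every element of the `χ₁`-augmentation submodule is the image of an element of the
`χ₀`-augmentation submodule (each generator `ω₁(ζ z) w − χ₁(z) w`, `w = Φ v`, is `Φ (ω₀(ζ z) v − χ₀(z) v)`; no
surjectivity of `τ` is needed since the ranges are already `k`-submodules).
[cite: Liu2021, App. D §D.1 Step 3 (l. 5221); Thm. 4.18 (3) proof l. 2272–2289] -/
theorem exists_mem_augmentation_apply_eq (Φ : V₀ →ₛₗ[τ] V₁)
    (hΦ : ∀ (z : Z) (v : V₀), Φ (ω₀ (ζ z) v) = ω₁ (ζ z) (Φ v))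
    (hχ : ∀ z : Z, ((χ₁ z : kˣ) : k) = τ ((χ₀ z : kˣ) : k)) (hsurj : Function.Surjective Φ)
    {y : V₁} (hy : y ∈ augmentation ω₁ ζ χ₁) : ∃ x ∈ augmentation ω₀ ζ χ₀, Φ x = y := by
  induction hy using Submodule.iSup_induction' with
  | mem z y hy =>
    obtain ⟨w, rfl⟩ := hy
    obtain ⟨v, rfl⟩ := hsurj w
    refine ⟨ω₀ (ζ z) v - ((χ₀ z : kˣ) : k) • v, sub_smul_mem_augmentation ω₀ ζ χ₀ z v, ?_⟩
    rw [semilinear_map_generator ω₀ ω₁ ζ χ₀ χ₁ Φ hΦ hχ z v]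
    rfl
  | zero => exact ⟨0, Submodule.zero_mem _, map_zero Φ⟩
  | add y y' _ _ hx hx' =>
    obtain ⟨x, hx, rfl⟩ := hx
    obtain ⟨x', hx', rfl⟩ := hx'
    exact ⟨x + x', Submodule.add_mem _ hx hx', map_add Φ x x'⟩

/-- **the descended map intertwines the maximal quotients**: for a `τ`-semilinear intertwiner `Φ` of `ω₀`, `ω₁` on ALL
of `G` and `χ₁ = τ ∘ χ₀`, `mapQ Φ (quotRep ω₀ g x) = quotRep ω₁ g (mapQ Φ x)`.
[cite: Liu2021, App. D §D.1 Step 3 (l. 5221); Thm. 4.18 (3) proof l. 2272–2289] -/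
theorem mapQ_quotRep (hζ : ∀ z, ζ z ∈ Subgroup.center G) (Φ : V₀ →ₛₗ[τ] V₁)
    (hΦ : ∀ (g : G) (v : V₀), Φ (ω₀ g v) = ω₁ g (Φ v))
    (hχ : ∀ z : Z, ((χ₁ z : kˣ) : k) = τ ((χ₀ z : kˣ) : k)) (g : G) (x : V₀ ⧸ augmentation ω₀ ζ χ₀) :
    (augmentation ω₀ ζ χ₀).mapQ (augmentation ω₁ ζ χ₁) Φ
        (augmentation_le_comap_semilinear ω₀ ω₁ ζ χ₀ χ₁ Φ (fun z v => hΦ (ζ z) v) hχ) (quotRep ω₀ hζ χ₀ g x) =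
      quotRep ω₁ hζ χ₁ g ((augmentation ω₀ ζ χ₀).mapQ (augmentation ω₁ ζ χ₁) Φ
        (augmentation_le_comap_semilinear ω₀ ω₁ ζ χ₀ χ₁ Φ (fun z v => hΦ (ζ z) v) hχ) x) := by
  obtain ⟨v, rfl⟩ := Submodule.mkQ_surjective _ x
  rw [Submodule.mkQ_apply, quotRep_mk, Submodule.mapQ_apply, Submodule.mapQ_apply, quotRep_mk, hΦ]

/-- **bijectivity**: if `Φ` is a BIJECTIVE `τ`-semilinear intertwiner (on the centre) with `χ₁ = τ ∘ χ₀`, the descended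
map of maximal quotients is bijective (onto: clear; one-to-one: `Φ⁻¹` of the `χ₁`-augmentation is the
`χ₀`-augmentation, `exists_mem_augmentation_apply_eq`). [cite: Liu2021, App. D §D.1 Step 3 (l. 5221); Thm. 4.18 (3) proof l. 2272–2289] -/
theorem mapQ_bijective_of_bijective (Φ : V₀ →ₛₗ[τ] V₁)
    (hΦ : ∀ (z : Z) (v : V₀), Φ (ω₀ (ζ z) v) = ω₁ (ζ z) (Φ v))
    (hχ : ∀ z : Z, ((χ₁ z : kˣ) : k) = τ ((χ₀ z : kˣ) : k)) (hbij : Function.Bijective Φ) :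
    Function.Bijective ((augmentation ω₀ ζ χ₀).mapQ (augmentation ω₁ ζ χ₁) Φ
      (augmentation_le_comap_semilinear ω₀ ω₁ ζ χ₀ χ₁ Φ hΦ hχ)) := by
  constructor
  · -- one-to-one: a class whose image dies has a representative mapping into the `χ₁`-augmentation, which is the
    -- image of the `χ₀`-augmentation
    rw [injective_iff_map_eq_zero]
    intro x hx
    obtain ⟨v, rfl⟩ := Submodule.mkQ_surjective _ x
    rw [Submodule.mkQ_apply, Submodule.mapQ_apply, Submodule.Quotient.mk_eq_zero] at hx
    obtain ⟨u, hu, huv⟩ := exists_mem_augmentation_apply_eq ω₀ ω₁ ζ χ₀ χ₁ Φ hΦ hχ hbij.2 hx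
    rw [Submodule.mkQ_apply, Submodule.Quotient.mk_eq_zero, ← hbij.1 huv]
    exact hu
  · -- onto
    intro y
    obtain ⟨w, rfl⟩ := Submodule.mkQ_surjective _ y
    obtain ⟨v, rfl⟩ := hbij.2 w
    exact ⟨Submodule.Quotient.mk v, rfl⟩

/-- **EXISTENCE FORM (the shape of the road's binder `LocalTypeGaloisTwist`)**: a bijective `τ`-semilinear intertwiner
`Φ` of `ω₀` with `ω₁` on `G`, with `χ₁ = τ ∘ χ₀` on the centre, yields a bijective `τ`-semilinear map of the maximal
quotients `V₀ ⧸ augmentation ω₀ ζ χ₀ → V₁ ⧸ augmentation ω₁ ζ χ₁` intertwining `quotRep ω₀ hζ χ₀` with `quotRep ω₁ hζ χ₁`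
— «the `σ`-twist of the maximal `χ`-quotient is the maximal `(σ ∘ χ)`-quotient of the `σ`-twist».
[cite: Liu2021, App. D §D.1 Step 3 (l. 5221); Thm. 4.18 (3) proof l. 2272–2289] [cite: MoeglinVignerasWaldspurger1987, Chap. 2 II.1] -/
theorem exists_semilinear_quotRep_of_bijective (hζ : ∀ z, ζ z ∈ Subgroup.center G) (Φ : V₀ →ₛₗ[τ] V₁)
    (hΦ : ∀ (g : G) (v : V₀), Φ (ω₀ g v) = ω₁ g (Φ v))
    (hχ : ∀ z : Z, ((χ₁ z : kˣ) : k) = τ ((χ₀ z : kˣ) : k)) (hbij : Function.Bijective Φ) :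
    ∃ h : (V₀ ⧸ augmentation ω₀ ζ χ₀) →ₛₗ[τ] (V₁ ⧸ augmentation ω₁ ζ χ₁), Function.Bijective h ∧
      ∀ (g : G) (x : V₀ ⧸ augmentation ω₀ ζ χ₀), h (quotRep ω₀ hζ χ₀ g x) = quotRep ω₁ hζ χ₁ g (h x) :=
  ⟨(augmentation ω₀ ζ χ₀).mapQ (augmentation ω₁ ζ χ₁) Φ
      (augmentation_le_comap_semilinear ω₀ ω₁ ζ χ₀ χ₁ Φ (fun z v => hΦ (ζ z) v) hχ),
    mapQ_bijective_of_bijective ω₀ ω₁ ζ χ₀ χ₁ Φ (fun z v => hΦ (ζ z) v) hχ hbij,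
    mapQ_quotRep ω₀ ω₁ ζ χ₀ χ₁ hζ Φ hΦ hχ⟩

/-- the same along a homomorphism of acting groups `φ : G' →* G` on the source side read through `comp`: if `Φ`
intertwines `ω₀ ∘ φ` with `ω₁ ∘ φ` — convenience instance of `exists_semilinear_quotRep_of_bijective` for the pulled-back
representations (centre `ζ' : Z →* G'` with `φ ∘ ζ'` central is NOT assumed; `ζ'` itself must be central in `G'`).
[cite: Liu2021, App. D §D.1 Step 3 (l. 5221); Thm. 4.18 (3) proof l. 2272–2289] -/
theorem exists_semilinear_quotRep_comp_of_bijective {G' : Type*} [Group G'] (φ : G' →* G) (ζ' : Z →* G')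
    (hζ' : ∀ z, ζ' z ∈ Subgroup.center G') (Φ : V₀ →ₛₗ[τ] V₁)
    (hΦ : ∀ (g : G') (v : V₀), Φ (ω₀ (φ g) v) = ω₁ (φ g) (Φ v))
    (hχ : ∀ z : Z, ((χ₁ z : kˣ) : k) = τ ((χ₀ z : kˣ) : k)) (hbij : Function.Bijective Φ) :
    ∃ h : (V₀ ⧸ augmentation (ω₀.comp φ) ζ' χ₀) →ₛₗ[τ] (V₁ ⧸ augmentation (ω₁.comp φ) ζ' χ₁), Function.Bijective h ∧
      ∀ (g : G') (x : V₀ ⧸ augmentation (ω₀.comp φ) ζ' χ₀),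
        h (quotRep (ω₀.comp φ) hζ' χ₀ g x) = quotRep (ω₁.comp φ) hζ' χ₁ g (h x) :=
  exists_semilinear_quotRep_of_bijective (ω₀.comp φ) (ω₁.comp φ) ζ' χ₀ χ₁ hζ' Φ (fun g v => hΦ g v) hχ hbij

end Literature.RepresentationTheory.CentralCharacterQuotient
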